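import Summits.BirchSwinnertonDyer.Rank1Residual.ManinAdditive.ThetaBrandtDegreeLaws
import HarnessLib
import HarnessLib.Audit.Tags

/-!
# The V₄-sign (depth-two) Hurwitz Brandt module at 2 and the degree law at 8 ∥ N (cell bsd-f2-manin, desc g19, MEMO-desc §43)

TYPER NOTE (typer g19, T-desc-36 v2).  SOURCE = HOME/desc/g19/Sketch-desc-g19.lean sha16 4a2db05b0e9d2e61 (389 l.; desc: farm rc 0 · 0 err · 0 warn,
22.3 s, check-g19-v2.json 377b0f3b21689693; BC7 ProbeG19.txt 7ef6d349988ed063 3/3 + ProbeG19b.txt b246bbd95e911fe0 2/2 = 5/5 CLEAN; supersedes v1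
3d579e56dfd5661a), §1–§2b (l. 1–314) VERBATIM except this note and ONE lint repair: desc's anonymous `instance : Decidable (InOnePlusTwoO q)`
became the explicit `def InOnePlusTwoO.decidable` passed via `@decide` at its three call sites (statement files declare no instances); SPLIT for the 400-line cap: §3 (the `decide +kernel` certificates `g88_*`, `g104_*`,
`g88/g104_piSign`, `g56b_certificate`, `isPrimitiveInt_of_apply_eq_one`, `card_onePlusTwoO_three_five`) = sibling `PsiBrandtDegreeLawAtEightCert.lean`;
E-desc-133's proof = sibling `PsiBrandtDegreeLawAtEightHolds.lean` (desc's Sketch-desc-g19-holds f1bf52a30c34e2b2, over p712586).  Namespace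
`…ManinAdditive.PsiBrandt` as written; imports ONLY `ThetaBrandtDegreeLaws` — ROUTE-INDEPENDENT.  HONEST FRAMING (typer summary; details = desc's text
below): LENS desc (modular degree via the ψ-isotypic Hurwitz Brandt module of `B_{2,∞}` = the conductor-8 supercuspidal JL type); STATUS: E-desc-131
`PsiBrandtNewLineAtEightPrime` SUPPORT (JL multiplicity one), E-desc-132 `PsiBrandtDegreeLawAtEightPrime` LAW, E-desc-133 `DiscriminantValuationAtEight`
DERIVED (plain def; = tree theorem p712586, closed in the Holds sibling), E-desc-134 `PsiBrandtPiSignLawAtEightPrime` DICTIONARY LAW, E-desc-135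
`PsiBrandtCentringLawAtEightPrime` LAW; PROVED `padicValInt_modularDegree_eq_of_psiBrandtDegreeLaw`, `isFaceCentred_of_isAllOdd`,
`modularDegree_eq_psiHeight_of_II_star`; NOT IN PRINT (Brandt modules with non-Eichler level at 2: no Magma `BrandtModule`; nearest Gross 1987 /
Pollack–Weston 2011 Thm 6.8 / HPS 1989 special orders); BC5 (desc HOME/desc/g19/b8/: B8-all.tsv + CENSUS-8-insample.md = ALL 3153 optimal curves
`8 ∥ N < 10⁴` (512 levels) + out-of-sample B8-oos.tsv + CENSUS-8-oos.md = ALL 3387 with `10⁴ ≤ N < 2·10⁴`): E-132 6540/6540, E-134 3153/3153 (OOS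
running), E-135 3153/3153 + 3387/3387; JL dimension identity 1010/1010 levels; REFUTER VERDICTS: ref1 R-desc-34 (+2 rows) PENDING at filing; ref2
PENDING.  CHEAPEST FALSIFIERS (desc): any optimal curve `8 ∥ N ≥ 2·10⁴` (D-desc-32, prime `M`, `N ≤ 1.3·10⁵`); a III/III* curve with `t₂ = 1`
unhalved; second engine with ≥ 16 Hecke test primes mandatory at `9 ∣ M`.  WHY IT MATTERS: at `8 ∥ N` `ord₂ deg φ = ord₂ H + e − 1 − 2t₂` — no
Tamagawa number enters (C2 currency for the ČNS inequality at `8 ∥ N`).  PARTITION 0 · beyond-print theorem: no · bears_on: stmt-BirchSwinnertonDyer-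
22967 (C2).  BSD is not proved by this; Manin's conjecture is not proved by this; C2/C3 OPEN.

Rows E-desc-131 `PsiBrandtNewLineAtEightPrime` (JL multiplicity one, support), E-desc-132 `PsiBrandtDegreeLawAtEightPrime`
(LAW), E-desc-133 `DiscriminantValuationAtEight` (E-facing support `8 ∥ N ⟹ v₂(Δ_min) ∈ {4, 8, 10, 11}` — DERIVED from the
tree theorem of p712586 in the companion `…Holds` file), kernel
certificates `g88` (88a1, `I₁*`, body-centred) and `g104` (104a1, `II*`, face-centred).  Nothing is asserted: the rows are
`def … : Prop` tagged `@[conjecture]`; the certificates are `decide +kernel` evaluations of the computable model of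
`HurwitzBrandtTwoEisenstein.lean` (`DQuat`, `hurwitzOfNorm`, `act`).

THE MODULE.  `O` = Hurwitz order of `B_{2,∞}`, `O^× = 2T` (24 units), `Q₈ = {±1, ±i, ±j, ±k} ⊂ 2T` (the preimage of
`V₄ ⊂ A₄ = 2T/±1 = O₂^×/(1+𝔓²)`).  A weight-2 newform with `8 ∥ N` is supercuspidal at 2 of conductor exponent 3; under
Jacquet–Langlands it corresponds to the representations of `D₂^×` trivial on `1+𝔓²` and non-trivial on `1+𝔓`, i.e. to the
3-dimensional representation `ρ₃` of `A₄`, and `ρ₃|V₄ = ψ_i ⊕ ψ_j ⊕ ψ_k` (the three non-trivial characters).  For the level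
`U = ℚ₂^×(1+𝔓²) × K₀(M)` (`M` odd) the class set is `2T \ (A₄ × ℙ¹(ℤ/M)) = ℙ¹(ℤ/M)` with ALL stabilisers `±1` (uniform
measure), and the `ψ = ψ_i`-isotypic piece of the Brandt module is
  `𝓜_ψ(M) = {g : ℙ¹(ℤ/M) → ℤ : g(u·x) = ψ(u) g(x), u ∈ Q₈}`,  `ψ(±1) = ψ(±i) = 1`, `ψ(±j) = ψ(±k) = −1`,
with Hecke operators `(T_ℓ g)(x) = ½ Σ_{γ ∈ O, Nrd γ = ℓ, γ ≡ 1 (mod 2O)} g(γ·x)` (`ℓ` odd, `ℓ ∤ M`; the `2(ℓ+1)` elements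
`≡ 1 (mod 2O)` are `±` one per left unit coset) and HEIGHT `H(g) = Σ_x g(x)²`.  JL dimension identity (checked at all
1010 odd levels `M ≤ 2499` met below): `rk 𝓜_ψ(M) = dim S₂(Γ₀(8M))^{[f₂ = 3]} = g₀(8M) − 2g₀(4M) + g₀(2M)` (`= ⌊(p+1)/4⌋`
at `M = p`).  The E-isotypic lattice `X_E ⊂ ℤ^{ℙ¹(ℤ/M)}` (rank 3, an `A₄`-lattice in `ρ₃ ⊗ ℚ`) contains
the ORTHOGONAL frame `ℤg ⊕ ℤ(g∘ζ) ⊕ ℤ(g∘ζ²)` (`ζ = (−1+i+j+k)/2`; three vectors of norm `H(g)`) with 2-primary index 1, 2 or 4 —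
primitive-cubic, body-centred or face-centred — and
`t₂(E) := [X_E face-centred] = [2 ∣ g + g∘ζ pointwise]`.

THE LAW (E-desc-132; census HOME/desc/g19/b8/: B8-all.tsv + CENSUS-8-insample.md = ALL 3153 optimal curves with `8 ∥ N < 10⁴`
(512 levels), then out-of-sample B8-oos.tsv + CENSUS-8-oos.md = ALL 3387 optimal curves with `10⁴ ≤ 8 ∥ N < 2·10⁴` (498 levels):
6540/6540, 0 exceptions):
  `2^{1 + 2 t₂(E)} · deg φ_E = 2^{e(E)} · H(g_E)`,  `e = 0, 1, 2, 3` for Kodaira `III, I₁*, III*, II*` at 2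
(equivalently `v₂(Δ_min) = 4, 8, 10, 11` — the only values at `8 ∥ N`, E-desc-133), i.e. `deg φ = 2^{e−2} · ‖u_E‖²` with
`u_E` the primitive vector of `ℤ^{ℙ¹}` on the face-diagonal line `ℚ(g + g∘ζ)`.  Lattice types met: `III` body-centred
1060/1060, `II*` face-centred 418/418, `III*` primitive 652 + face-centred 3 (56b1, 184c1, 248b1), `I₁*` body-centred 1016 +
primitive 2 (40a1, 120b1) + face-centred 2 (24a1, 56a1).

ADDENDUM (§2b, MEMO-desc §43.7): E-desc-134 — the involution `g ↦ g∘Π` (`Π = 1+i`) acts on the JL line by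
`w(E)·a_p(E)` = the Atkin–Lehner sign at 8 (3153/3153); E-desc-135 — face-centred ⟺ `II*` ∨ `g` all-odd (the mod-2
Eisenstein vector; 3153/3153 + 3387/3387), so `deg φ` is a function of `H(g)`, the Kodaira symbol and `[ḡ = 1̄]`.

bears_on: stmt-BirchSwinnertonDyer-22967 (C2) via the exact 2-adic valuation of deg φ at 8 ∥ N (input of the ČNS inequality
`ord₂ c_E ≤ ord₂ deg φ + …`).  BSD is not proved by this; Manin's conjecture is not proved by this; C2/C3 OPEN.
-/

open scoped MatrixGroups ModularForm

open CongruenceSubgroup WeierstrassCurve Literature.NumberTheory.EllipticCurves.ModularForms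
open Summit.BirchSwinnertonDyer.Rank1Residual.ManinAdditive.HurwitzBrandt

namespace Summit.BirchSwinnertonDyer.Rank1Residual.ManinAdditive.PsiBrandt

/-! ### §1. The ψ-isotypic (V₄-sign) Hurwitz Brandt module at prime level `M = p` (computable model) -/

/-- the quaternion group `Q₈ = {±1, ±i, ±j, ±k} ⊂ O^×` in doubled coordinates. [folklore] -/
def quatQ8 : List DQuat :=
  [(2, 0, 0, 0), (-2, 0, 0, 0), (0, 2, 0, 0), (0, -2, 0, 0), (0, 0, 2, 0), (0, 0, -2, 0), (0, 0, 0, 2), (0, 0, 0, -2)]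

/-- the `V₄`-character `ψ = ψ_i` on `Q₈`: `+1` on `±1, ±i`, `−1` on `±j, ±k` (read off the vanishing of the `j`- and
`k`-coordinates; only ever applied to elements of `quatQ8`). [folklore] -/
def psiSign (u : DQuat) : ℤ := if u.2.2.1 = 0 ∧ u.2.2.2 = 0 then 1 else -1

/-- `q ≡ 1 (mod 2O)`: the doubled coordinates of `q − 1`, i.e. `(A − 2, B, C, D)`, are all `≡ 0 (mod 4)` or all
`≡ 2 (mod 4)` (`2O` in doubled coordinates = the quadruples all `≡ 0` or all `≡ 2 (mod 4)`).  The units `≡ 1 (mod 2O)`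
are `±1`; each left unit coset of an element of odd norm contains exactly two such elements, `±` each other. [folklore] -/
def InOnePlusTwoO (q : DQuat) : Prop :=
  (q.1 % 4 = 2 ∧ q.2.1 % 4 = 0 ∧ q.2.2.1 % 4 = 0 ∧ q.2.2.2 % 4 = 0) ∨
    (q.1 % 4 = 0 ∧ q.2.1 % 4 = 2 ∧ q.2.2.1 % 4 = 2 ∧ q.2.2.2 % 4 = 2)

/-- Decidability of `InOnePlusTwoO`, as an explicit `def` (statement files declare no `instance`s — typer g19; desc's sketch had an
anonymous `instance` here; the three call sites pass it explicitly via `@decide`). -/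
def InOnePlusTwoO.decidable (q : DQuat) : Decidable (InOnePlusTwoO q) := by unfold InOnePlusTwoO; infer_instance

/-- ψ-EQUIVARIANCE of `g : ℙ¹(𝔽_p) → ℤ`: `ψ(u) g(u·x) = g(x)` for the eight `u ∈ Q₈`; `𝓜_ψ(p)` = the ψ-equivariant
functions (a point with stabiliser `±j` or `±k` in `Q₈` is forced to value `0`). [folklore] -/
def IsPsiEquivariant (p : ℕ) (g : Fin (p + 1) → ℤ) : Prop :=
  ∀ u ∈ quatQ8, ∀ x : Fin (p + 1), psiSign u * g (act p u x) = g x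

/-- PRIMITIVITY of an integer point function: the values are coprime (every common divisor divides 1). [folklore] -/
def IsPrimitiveInt (p : ℕ) (g : Fin (p + 1) → ℤ) : Prop :=
  ∀ d : ℤ, (∀ x : Fin (p + 1), d ∣ g x) → d ∣ 1

/-- TWICE THE HECKE OPERATOR `T_ℓ` on point functions: `(2T_ℓ g)(x) = Σ_{γ ∈ O, Nrd γ = ℓ, γ ≡ 1 (mod 2O)} g(γ·x)`
(`2(ℓ+1)` terms, `±` one per left unit coset; `ℓ` an odd prime `≠ p`; preserves ψ-equivariance since `Q₈ ⊲ O^×` and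
`u(1 + 2O)u⁻¹ = 1 + 2O`). [folklore] -/
def psiHeckeTwice (p ℓ : ℕ) (g : Fin (p + 1) → ℤ) (x : Fin (p + 1)) : ℤ :=
  (((hurwitzOfNorm ℓ).filter fun γ => @decide (InOnePlusTwoO γ) (InOnePlusTwoO.decidable γ)).map fun γ => g (act p γ x)).sum

/-- `g` is a HECKE EIGENFUNCTION with eigenvalues `a = (a_ℓ)`: `2T_ℓ g = 2a_ℓ · g` for every odd prime `ℓ ≠ p`. [folklore] -/
def IsPsiHeckeEigen (p : ℕ) (g : Fin (p + 1) → ℤ) (a : ℕ → ℤ) : Prop :=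
  ∀ ℓ : ℕ, ℓ.Prime → ℓ ≠ 2 → ℓ ≠ p → ∀ x : Fin (p + 1), psiHeckeTwice p ℓ g x = 2 * a ℓ * g x

/-- the HEIGHT `H(g) = Σ_{x ∈ ℙ¹(𝔽_p)} g(x)²` (uniform measure: every class of `2T \ (A₄ × ℙ¹)` has stabiliser `±1`).
[folklore] -/
def psiHeight (p : ℕ) (g : Fin (p + 1) → ℤ) : ℤ :=
  ((List.finRange (p + 1)).map fun x => g x ^ 2).sum

/-- the unit `ζ = (−1 + i + j + k)/2` of order 3 (doubled coordinates); conjugation by `ζ` permutes `i → j → k` and the three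
characters `ψ_i, ψ_j, ψ_k`, so `g ∘ ζ` spans the `ψ'`-line of the same eigen-system. [folklore] -/
def zetaUnit : DQuat := (-1, 1, 1, 1)

/-- the FACE-CENTRED bit `t₂ = 1`: `g + g∘ζ ≡ 0 (mod 2)` pointwise, i.e. `(g + g∘ζ)/2` lies in `ℤ^{ℙ¹}` — the
E-isotypic `A₄`-lattice has 2-primary index 4 over `ℤg ⊕ ℤ(g∘ζ) ⊕ ℤ(g∘ζ²)` (one face-diagonal half-sum integral forces all
three, by the `ζ`-symmetry). [folklore] -/
def IsFaceCentred (p : ℕ) (g : Fin (p + 1) → ℤ) : Prop :=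
  ∀ x : Fin (p + 1), (g x + g (act p zetaUnit x)) % 2 = 0

/-- `Π = 1 + i` in doubled coordinates: a generator of the prime `𝔓 = ΠO` over `2`; conjugation by `Π` fixes `±i` and swaps
`±j ↔ ±k`, so `g ↦ g∘Π` preserves the `ψ`-isotypic module and commutes with the `T_ℓ`; on it `(g∘Π)∘Π = g∘(2i) = g`, an
INVOLUTION — the Jacquet–Langlands shadow of the Atkin–Lehner involution `W₈` (E-desc-134). [folklore] -/
def piQuat : DQuat := (2, 2, 0, 0)

/-- `g` takes only ODD values: then `g mod 2` is the constant function `1̄` on `ℙ¹(𝔽_p)`, the mod-2 EISENSTEIN vector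
(`2T_ℓ 1̄ = 2(ℓ+1)·1̄`), which forces `a_ℓ(E) ≡ ℓ + 1 ≡ 0 (mod 2)` for all odd `ℓ ≠ p`, i.e. `E(ℚ)[2] ≠ 0`, and `p ≡ 3 (mod 4)`
(at `p ≡ 1 (mod 4)` the points of `ℙ¹(𝔽_p)` fixed by `±j` carry `g = 0`). Trivially `IsAllOdd → IsFaceCentred`. [folklore] -/
def IsAllOdd (p : ℕ) (g : Fin (p + 1) → ℤ) : Prop :=
  ∀ x : Fin (p + 1), g x % 2 = 1

/-- the BRANDT EXPONENT `e(E) ∈ {0, 1, 2, 3}` at `8 ∥ N`, keyed to `v₂(Δ)` of the (globally minimal) model: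
`4 ↦ 0` (III), `8 ↦ 1` (I₁*), `10 ↦ 2` (III*), anything else (`11`, II*) `↦ 3`. [folklore] -/
noncomputable def brandtExponentAtEight (W : WeierstrassCurve ℚ) : ℕ :=
  if padicValRat 2 W.Δ = 4 then 0 else if padicValRat 2 W.Δ = 8 then 1 else if padicValRat 2 W.Δ = 10 then 2 else 3

/-! ### §2. Rows -/

/-- **Row E-desc-133 `DiscriminantValuationAtEight` (E-facing support, DERIVED — it is the tree theorem
`ManinLocalTwoThree.padicValRat_two_Δ_of_padicValNat_conductorNorm_eq_three` (p712586, seat bsd-line-manin23-p3); the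
one-line proof `discriminantValuationAtEight_holds` lives in the companion file `PsiBrandtDegreeLawAtEightHolds.lean` (which imports
that Theorems module; kept out of this statement file to keep its import cone inside `ManinAdditive`); census: all 168 136 optimal curves with `8 ∥ N < 5·10⁵` have
`(Kodaira, v₂(Δ), c₂) ∈ {(III,4,2), (I₁*,8,2|4), (III*,10,2), (II*,11,1)}`).**  `8 ∥ N ⟹ v₂(Δ_min) ∈ {4, 8, 10, 11}`.
[cite: Papadopoulos1993, Table IV (p = 2): the triples (Kodaira type, v(Δ), f)] -/
def DiscriminantValuationAtEight : Prop :=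
  ∀ (W : WeierstrassCurve ℚ) [W.IsElliptic] [W.IsGloballyMinimal],
    padicValNat 2 (W.conductorNorm ℤ) = 3 →
    padicValRat 2 W.Δ = 4 ∨ padicValRat 2 W.Δ = 8 ∨ padicValRat 2 W.Δ = 10 ∨ padicValRat 2 W.Δ = 11

/-- **Row E-desc-131 `PsiBrandtNewLineAtEightPrime` (MULTIPLICITY ONE at ψ-level; construction statement for E-desc-132;
nothing asserted).**  For every elliptic curve of conductor `8p`, `p` an odd prime, the `(a_ℓ(E))`-eigenfunctions of `𝓜_ψ(p)`
form a free `ℤ`-module of rank one: a primitive ψ-equivariant Hecke-eigen `g` EXISTS and is unique up to sign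
(Jacquet–Langlands for the conductor-8 supercuspidal at 2 + newform theory; census: a rank-1 eigenline found at 3153/3153
optimal curves `8 ∥ N < 10⁴` and 3387/3387 with `10⁴ ≤ N < 2·10⁴` — with ≥ 16 Hecke primes where `9 ∣ M`, since `χ₋₃`-congruent
eigenlines agree at all `ℓ ≤ 31` twice (13896f/g); JL dimension identity at all 1010 levels).
[cite: Pizer1980, Thm. 3.13 (shape: Brandt matrices of 2-adically non-Eichler level realise the new space — the ψ-isotypic form is the cell's, MEMO-desc §43, NOT in print as far as searched)] -/
@[conjecture]
def PsiBrandtNewLineAtEightPrime : Prop :=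
  ∀ (p : ℕ), p.Prime → p ≠ 2 →
  ∀ (W : WeierstrassCurve ℚ) [W.IsElliptic], W.conductorNorm ℤ = 8 * p →
    (∃ g : Fin (p + 1) → ℤ, IsPsiEquivariant p g ∧ IsPrimitiveInt p g ∧ IsPsiHeckeEigen p g fun n => W.LFunction n) ∧
    ∀ g g' : Fin (p + 1) → ℤ,
      IsPsiEquivariant p g → IsPrimitiveInt p g → IsPsiHeckeEigen p g (fun n => W.LFunction n) →
      IsPsiEquivariant p g' → IsPrimitiveInt p g' → IsPsiHeckeEigen p g' (fun n => W.LFunction n) →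
      (g' = g ∨ g' = -g)

open scoped Classical in
/-- **Row E-desc-132 `PsiBrandtDegreeLawAtEightPrime` — THE ψ-BRANDT DEGREE LAW at `8 ∥ N`, prime cofactor `M = p`
(LAW; cell bsd-f2-manin, desc g19, MEMO-desc §43; nothing asserted).**  For the `X₀(8p)`-optimal curve `E` (lattice clause +
minimal-degree clause) and any primitive ψ-equivariant Hecke eigenfunction `g` for `(a_ℓ(E))`:
  `2^{1 + 2t₂} · deg φ_E = 2^{e(E)} · H(g)`,  `t₂ = [IsFaceCentred p g]`, `e(E) = brandtExponentAtEight E ∈ {0,1,2,3}`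
(`III, I₁*, III*, II*`), i.e. `deg φ_E = 2^{e(E) − 2} ‖u_E‖²` for the primitive vector `u_E` on the line `ℚ(g + g∘ζ)`.
Census (BC5 witness): ALL 3153 optimal curves with `8 ∥ N < 10⁴` (512 levels, `M` prime or not, 0 exceptions; deg φ/H =
1/2 on the 1060 `III`, 1 on the 418 `II*`, 2 | 1/2 on the 652 | 3 `III*`, 1 | 1/4 on the 1018 | 2 `I₁*`), out-of-sample
`10⁴ ≤ N < 2·10⁴`: 3387/3387 (CENSUS-8-oos.md; every lattice type generic there); prime `M = p`: every optimal curve of conductor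
`8p < 2·10⁴`.  Why it might fail: a curve
whose E-isotypic `A₄`-lattice is none of primitive / body-centred / face-centred (index 8 is impossible, but a body-centred
`II*` or a face-centred `III` is allowed by the bit law, but a fourth centring type is not: none in 6540); a congruence between `f_E` and another
`f₂ = 3` newform invisible in `X₀(8p)` (the additive Ribet–Takahashi comparison at a WILD supercuspidal prime, OPEN).
[cite: PollackWeston2011, Thm. 6.8 with Prop. 6.7 (tree `PollackWeston2011.thm_6_8_ellipticCurve`: squarefree level, ord_p δ_f = ord_p ξ_f + Σ t_f(q) — the shape whose wild additive analogue at 2 this row is; NOT in print)]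
[cite: Gross1987Heights, §§1–4 (heights on Brandt modules at prime level, trivial character)] -/
@[conjecture]
def PsiBrandtDegreeLawAtEightPrime : Prop :=
  ∀ (p : ℕ), p.Prime → p ≠ 2 →
  ∀ (W : WeierstrassCurve ℚ) [W.IsElliptic] [W.IsGloballyMinimal] [NeZero (W.conductorNorm ℤ)]
    (D : ModularParametrizationData W (W.conductorNorm ℤ)),
    W.conductorNorm ℤ = 8 * p →
    (∀ z ∈ D.L.lattice, ∃ w ∈ periodLattice D.f, z = D.c * w) →
    (∀ (W' : WeierstrassCurve ℚ) [W'.IsElliptic]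
        (D' : ModularParametrizationData W' (W.conductorNorm ℤ)),
        D'.f = D.f → D.modularDegree ≤ D'.modularDegree) →
  ∀ g : Fin (p + 1) → ℤ,
    IsPsiEquivariant p g → IsPrimitiveInt p g → IsPsiHeckeEigen p g (fun n => W.LFunction n) →
    (2 : ℤ) ^ (1 + 2 * (if IsFaceCentred p g then 1 else 0)) * (D.modularDegree : ℤ) =
      2 ^ (brandtExponentAtEight W) * psiHeight p g

/-- the prime-to-2 EDGE of the law: for an odd prime `ℓ`, `ord_ℓ deg φ = ord_ℓ H(g)` (the Ribet–Takahashi content at the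
primes `ℓ ≥ 3`). -/
theorem padicValInt_modularDegree_eq_of_psiBrandtDegreeLaw (h : PsiBrandtDegreeLawAtEightPrime)
    (p : ℕ) (hp : p.Prime) (hp2 : p ≠ 2)
    (W : WeierstrassCurve ℚ) [W.IsElliptic] [W.IsGloballyMinimal] [NeZero (W.conductorNorm ℤ)]
    (D : ModularParametrizationData W (W.conductorNorm ℤ)) (hN : W.conductorNorm ℤ = 8 * p)
    (hΛ : ∀ z ∈ D.L.lattice, ∃ w ∈ periodLattice D.f, z = D.c * w)
    (hmin : ∀ (W' : WeierstrassCurve ℚ) [W'.IsElliptic] (D' : ModularParametrizationData W' (W.conductorNorm ℤ)),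
        D'.f = D.f → D.modularDegree ≤ D'.modularDegree)
    (g : Fin (p + 1) → ℤ) (hψ : IsPsiEquivariant p g) (hprim : IsPrimitiveInt p g)
    (heig : IsPsiHeckeEigen p g fun n => W.LFunction n)
    (ℓ : ℕ) (hℓ : ℓ.Prime) (hℓ2 : ℓ ≠ 2) :
    padicValInt ℓ (D.modularDegree : ℤ) = padicValInt ℓ (psiHeight p g) := by
  classical
  have key := h p hp hp2 W D hN hΛ hmin g hψ hprim heig
  haveI : Fact ℓ.Prime := ⟨hℓ⟩
  have h2 : ¬ (ℓ : ℤ) ∣ 2 := by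
    intro hd
    have : (ℓ : ℤ) ∣ ((2 : ℕ) : ℤ) := by simpa using hd
    have h' : ℓ ∣ 2 := by exact_mod_cast this
    have := (Nat.prime_dvd_prime_iff_eq hℓ Nat.prime_two).1 h'
    exact hℓ2 this
  have hpow : ∀ n : ℕ, padicValInt ℓ ((2 : ℤ) ^ n) = 0 := by
    intro n
    have h2n : padicValNat ℓ 2 = 0 := by
      rw [padicValNat.eq_zero_iff]
      exact Or.inr (Or.inr (by
        intro hd
        exact h2 (by exact_mod_cast hd)))
    simp [padicValInt, Int.natAbs_pow, padicValNat.pow, h2n]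
  by_cases hdeg : (D.modularDegree : ℤ) = 0
  · have hH : psiHeight p g = 0 := by
      rw [hdeg, mul_zero] at key
      rcases mul_eq_zero.1 key.symm with h0 | h0
      · exact absurd h0 (pow_ne_zero _ (by norm_num))
      · exact h0
    rw [hdeg, hH]
  · have hH : psiHeight p g ≠ 0 := by
      intro h0
      rw [h0, mul_zero] at key
      rcases mul_eq_zero.1 key with h1 | h1
      · exact pow_ne_zero _ (by norm_num) h1
      · exact hdeg h1
    have lhs := congrArg (padicValInt ℓ) key
    rw [padicValInt.mul (pow_ne_zero _ (by norm_num)) hdeg, padicValInt.mul (pow_ne_zero _ (by norm_num)) hH,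
      hpow, hpow, zero_add, zero_add] at lhs
    exact lhs

/-! ### §2b. The Π-involution and the centring bit (E-desc-134, E-desc-135; desc g19 addendum, MEMO-desc §43.7) -/

/-- **Row E-desc-134 `PsiBrandtPiSignLawAtEightPrime` — THE Π-INVOLUTION IS ATKIN–LEHNER AT 8 (DICTIONARY LAW; cell
bsd-f2-manin, desc g19, MEMO-desc §43.7; nothing asserted).**  For `N = 8p` and any primitive ψ-equivariant Hecke eigenfunction
`g` for `(a_ℓ(E))`: `g(Π·x) = w(E) · a_p(E) · g(x)` for all `x ∈ ℙ¹(𝔽_p)`, where `w(E) = W.rootNumber` is the global root number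
and `a_p(E) = −ε_p ∈ {±1}` (multiplicative reduction at `p`); equivalently the `Π`-sign of the JL line is the local root number
/ `W₈`-eigenvalue `w₂(E) = −w(E)·ε_p(E)`.  It says which of the TWO conductor-8 supercuspidal types (`ρ₃` vs `ρ₃ ⊗ sgn` of
`S₄ = D₂^×/ℚ₂^×(1+𝔓²)`, swapped by the unramified quadratic twist) `π_{E,2}` is.  Census (BC5 witness, with `w(E)` read as
`(−1)^{rank}` from Cremona's table, i.e. through BSD-parity / Gross–Zagier–Kolyvagin in ranks 0, 1): `ε_Π(g_E) = −(−1)^{rank} ∏_{q ∣ M} ε_q`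
for ALL 3153 optimal curves with `8 ∥ N < 10⁴` (any odd `M`, the `ε_q` being the Brandt-side Atkin–Lehner signs), 0 exceptions.
Why it might fail: only through a sign-convention slip between `Π` and `W₈` (a universal sign would show at once: it does not,
88a1 has `ε_Π = +1`, 104a1 has `ε_Π = −1`) or a failure of parity in rank ≥ 2 read through `(−1)^{rank}` (the statement itself
uses `W.rootNumber`, not the rank).
[cite: PollackWeston2011, §2 (Atkin–Lehner operators on definite quaternion algebras vs. newforms; squarefree level)]
[cite: Gross1987Heights, §§1–4] -/
@[conjecture]
def PsiBrandtPiSignLawAtEightPrime : Prop :=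
  ∀ (p : ℕ), p.Prime → p ≠ 2 →
  ∀ (W : WeierstrassCurve ℚ) [W.IsElliptic], W.conductorNorm ℤ = 8 * p →
  ∀ g : Fin (p + 1) → ℤ,
    IsPsiEquivariant p g → IsPrimitiveInt p g → IsPsiHeckeEigen p g (fun n => W.LFunction n) →
    ∀ x : Fin (p + 1), g (act p piQuat x) = W.rootNumber * W.LFunction p * g x

open scoped Classical in
/-- **Row E-desc-135 `PsiBrandtCentringLawAtEightPrime` — THE CENTRING BIT IS KODAIRA `II*` UP TO THE MOD-2 EISENSTEIN VECTOR
(LAW; cell bsd-f2-manin, desc g19, MEMO-desc §43.7; nothing asserted).**  For the `X₀(8p)`-optimal curve `E` (lattice +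
minimal-degree clauses, as in E-desc-132) and any primitive ψ-equivariant Hecke eigenfunction `g` for `(a_ℓ(E))`:
  `X_E` is FACE-CENTRED  ⟺  `v₂(Δ_E) = 11` (Kodaira `II*`)  ∨  `g` takes only odd values (`ḡ = 1̄`, the Eisenstein vector).
With E-desc-132 this makes `deg φ_E` a function of `H(g_E)`, the Kodaira symbol at 2 and the one predicate `IsAllOdd`:
`deg φ = 2^{e−1} H(g)` unless `II*` (`deg φ = H(g)`) or `ḡ = 1̄` (`deg φ = 2^{e−3} H(g)`).  Census (BC5 witness; mod-2 shape of
the JL vector recomputed for ALL 3153 optimal curves `8 ∥ N < 10⁴`, b8/e2/): face-centred = the 418 `II*` (none all-odd) + exactly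
24a1, 56a1 (`I₁*`), 56b1, 184c1, 248b1 (`III*`), all five ALL-ODD; no other curve is all-odd or face-centred; out of sample
(`10⁴ ≤ N < 2·10⁴`, 3387 curves) face-centred = the 544 `II*` exactly.  Finer mod-2 shape (not typed): the `O^×`-invariant
part `g + g∘ζ + g∘ζ² (mod 2)` VANISHES for every `III` and `I₁*` (2076/2080; the 4 exceptions 24a1, 40a1, 56a1, 120b1 have it
`= 1̄`), is `ḡ` itself and non-constant for every `II*` (418/418), and is non-zero non-constant for every `III*` (652/655; `= 1̄`
for 56b1, 184c1, 248b1).  At prime level `p ≡ 3 (mod 4)`: all-odd ⟺ `E(ℚ)[2] ≠ 0` (5/5 vs 0 others, `8p < 2·10⁴`).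
Why it might fail: a face-centred `I₁*`/`III*` optimal curve beyond `2·10⁴` whose JL vector is not the Eisenstein vector mod 2
(a non-Eisenstein mod-2 congruence forcing `g ≡ g∘ζ`), or a body-centred `II*`.
[cite: Gross1987Heights, §§1–4] [cite: PollackWeston2011, Thm. 6.8] -/
@[conjecture]
def PsiBrandtCentringLawAtEightPrime : Prop :=
  ∀ (p : ℕ), p.Prime → p ≠ 2 →
  ∀ (W : WeierstrassCurve ℚ) [W.IsElliptic] [W.IsGloballyMinimal] [NeZero (W.conductorNorm ℤ)]
    (D : ModularParametrizationData W (W.conductorNorm ℤ)),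
    W.conductorNorm ℤ = 8 * p →
    (∀ z ∈ D.L.lattice, ∃ w ∈ periodLattice D.f, z = D.c * w) →
    (∀ (W' : WeierstrassCurve ℚ) [W'.IsElliptic]
        (D' : ModularParametrizationData W' (W.conductorNorm ℤ)),
        D'.f = D.f → D.modularDegree ≤ D'.modularDegree) →
  ∀ g : Fin (p + 1) → ℤ,
    IsPsiEquivariant p g → IsPrimitiveInt p g → IsPsiHeckeEigen p g (fun n => W.LFunction n) →
    (IsFaceCentred p g ↔ (padicValRat 2 W.Δ = 11 ∨ IsAllOdd p g))

/-- the trivial half of the Eisenstein clause: an all-odd `g` is face-centred. -/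
theorem isFaceCentred_of_isAllOdd {p : ℕ} {g : Fin (p + 1) → ℤ} (h : IsAllOdd p g) : IsFaceCentred p g := by
  intro x
  have h1 := h x; have h2 := h (act p zetaUnit x)
  omega

/-- E-desc-132 + E-desc-135 at a `II*` optimal curve: `deg φ = H(g)` on the nose. -/
theorem modularDegree_eq_psiHeight_of_II_star (h132 : PsiBrandtDegreeLawAtEightPrime)
    (h135 : PsiBrandtCentringLawAtEightPrime)
    {p : ℕ} (hp : p.Prime) (hp2 : p ≠ 2)
    (W : WeierstrassCurve ℚ) [W.IsElliptic] [W.IsGloballyMinimal] [NeZero (W.conductorNorm ℤ)]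
    (D : ModularParametrizationData W (W.conductorNorm ℤ))
    (hN : W.conductorNorm ℤ = 8 * p)
    (hL : ∀ z ∈ D.L.lattice, ∃ w ∈ periodLattice D.f, z = D.c * w)
    (hmin : ∀ (W' : WeierstrassCurve ℚ) [W'.IsElliptic]
        (D' : ModularParametrizationData W' (W.conductorNorm ℤ)),
        D'.f = D.f → D.modularDegree ≤ D'.modularDegree)
    (g : Fin (p + 1) → ℤ) (hψ : IsPsiEquivariant p g) (hpr : IsPrimitiveInt p g)
    (hT : IsPsiHeckeEigen p g (fun n => W.LFunction n))
    (h11 : padicValRat 2 W.Δ = 11) :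
    (D.modularDegree : ℤ) = psiHeight p g := by
  classical
  have key := h132 p hp hp2 W D hN hL hmin g hψ hpr hT
  have hfc : IsFaceCentred p g := (h135 p hp hp2 W D hN hL hmin g hψ hpr hT).2 (Or.inl h11)
  have he : brandtExponentAtEight W = 3 := by
    unfold brandtExponentAtEight; simp [h11]
  rw [if_pos hfc, he] at key
  have : (2 : ℤ) ^ (1 + 2 * 1) = 2 ^ 3 := by norm_num
  rw [this] at key
  exact mul_left_cancel₀ (by norm_num) key

end Summit.BirchSwinnertonDyer.Rank1Residual.ManinAdditive.PsiBrandt
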